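import Mathlib.Analysis.SpecialFunctions.Exponential
import Mathlib.Analysis.Calculus.SmoothSeries
import Mathlib.Analysis.Calculus.FDeriv.Pow
import Mathlib.Analysis.Normed.Module.Connected
import HarnessLib

/-!
# The Fréchet derivative of `NormedSpace.exp` at a general point of a noncommutative Banach algebra
# (termwise derivative of the exponential series)

[folklore] matrix / Banach-algebra analysis, kernel-checked; Mathlib-only imports.  Written for the cell
`pub-balaban` (Bałaban YM₄ ultraviolet-stability audit), T4 programme, off-spine node T4-D.G-EML («BlockHaarAC of the
printed small-loop average», GAPS G-pv03-9 = `EML-HAARAC.md` §5, kernel brick (K1): "the Fréchet derivative of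
`NormedSpace.exp` at a general point of a noncommutative normed algebra"), row T4-D.G-EML-K1*.  VALUE: a reusable
calculus fact that Mathlib lacks; NOT an estimate of the manuscripts under audit, NOT summit progress.

WHAT MATHLIB HAS.  `hasFDerivAt_exp_zero` / `hasStrictFDerivAt_exp_zero` (the derivative `1` at `x = 0`),
`hasFDerivAt_exp_of_mem_ball` / `hasStrictFDerivAt_exp` (the derivative `exp x • 1` in a COMMUTATIVE Banach algebra),
`hasFDerivAt_exp_smul_const_of_mem_ball` & co. (the line `t ↦ exp (t • x)`), `NormedSpace.exp_analytic` (analyticity, no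
formula), and the noncommutative power rule `hasFDerivAt_pow'`
(`D(xⁿ) h = Σ_{i<n} x^{n−1−i} h x^i`) together with termwise differentiation of series
`hasFDerivAt_tsum_of_isPreconnected`.  The module docstring of `Mathlib.Analysis.SpecialFunctions.Exponential` lists no
general-point noncommutative derivative.

WHAT THE TREE ALREADY HAS (correction of record, v1.0.1).  `Literature.Analysis.Calculus.ExpDuhamel` (imported by the
cell's own `…Balaban1983to89.MatrixLog`) PROVES the general-point derivative of `exp` in a real Banach algebra
(`[NormedAlgebra ℝ 𝔸] [NormedAlgebra ℚ 𝔸] [CompleteSpace 𝔸]`) in DUHAMEL'S INTEGRAL FORM: `exp_sub_exp_eq_integral`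
(`exp y − exp x = ∫₀¹ exp((1−r)x) (y−x) exp(ry) dr`), `hasFDerivAt_exp_fderiv`, `fderiv_exp_apply_eq_integral`
(`D exp_x(h) = ∫₀¹ exp((1−r)x) h exp(rx) dr`), `fderiv_exp_apply_eq_exp_mul_integral`
(`= exp x · ∫₀¹ Ad(exp(−rx)) h dr`), `hasDerivAt_exp_comp` (along a curve), with the norm bounds `norm_exp_sub_one_le`
& co.; and `Literature.Analysis.Calculus.ExpLocalLieSubalgebra.exp_neg_mul_fderiv_exp_mem` (the trivialised
differential preserves an `Ad`-stable closed subalgebra).  The v1.0 sentence of this header «the project tree uses the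
derivative of `exp` only at `0`» was WRONG (a presearch miss of the filing seat, found after landing) and is withdrawn.
DELTA of this file relative to `ExpDuhamel`: the SERIES form; the derivative as an operator-norm-convergent `tsum` of
continuous linear maps, over `𝕂 ∈ {ℝ, ℂ}` (`[RCLike 𝕂]`, so `ℂ`-linear for `ℂ`-algebras) and without a
`[NormedAlgebra ℚ 𝔸]` argument; the explicit bound `‖D exp(x)‖ ≤ e^{‖x‖}`; the commuting case.  The two forms are
complementary (integral ⇔ series by expanding the exponentials under the integral — NOT proved here).

WHAT THIS FILE ADDS (all proved, axioms `propext`/`Classical.choice`/`Quot.sound` only).  For `𝕂 = ℝ` or `ℂ`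
(`[RCLike 𝕂]`) and a normed `𝕂`-algebra `𝔸` (`[NormedRing 𝔸] [NormedAlgebra 𝕂 𝔸]`; `[NormOneClass 𝔸]` from the norm
bounds on, `[CompleteSpace 𝔸]` from the main theorem on):
* `ExpFDeriv.term 𝕂 x n : 𝔸 →L[𝕂] 𝔸`, the derivative of `y ↦ (n!)⁻¹ • yⁿ` at `x`
  (`hasFDerivAt_term`), `term_apply` (`term x n h = (n!)⁻¹ • Σ_{i<n} x^{n−1−i} h x^i`), `term_zero`;
* `norm_term_le` (`‖x‖ ≤ R ⇒ ‖term x n‖ ≤ n R^{n−1}/n!`), `hasSum_bound` (`Σ_n n R^{n−1}/n! = e^R`), `summable_bound`,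
  `summable_norm_term`, `summable_term`;
* **`hasFDerivAt_exp`**: `HasFDerivAt exp (Σ' n, term 𝕂 x n) x` at EVERY `x` — the termwise derivative of the
  exponential series, converging in operator norm (proof: `hasFDerivAt_pow'` + `hasFDerivAt_tsum_of_isPreconnected` on
  the ball `‖y‖ < ‖x‖ + 1` with the bounds above + `NormedSpace.exp_eq_tsum`);
* `differentiableAt_exp`, `differentiable_exp`, `fderiv_exp`, the applied formula `fderiv_exp_apply`
  (`D exp(x) h = Σ' n (n!)⁻¹ • Σ_{i<n} x^{n−1−i} h x^i`), the bound `norm_fderiv_exp_le` (`‖D exp(x)‖ ≤ e^{‖x‖}`),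
  the directional derivative along an affine line `hasDerivAt_exp_add_smul`
  (`d/ds exp(x + s h) = D exp(x + s h) h`; cf. the tree's `hasDerivAt_exp_comp` (module `ExpDuhamel`) for a general curve, integral
  form), and the commuting sanity case `fderiv_exp_apply_of_commute`
  (`xh = hx ⇒ D exp(x) h = h · exp x`).

LITERATURE CONTEXT (orientation only — nothing below is used as a hypothesis; every declaration is kernel-proved).
The formula is the classical derivative of the matrix exponential: D. S. Bernstein, *Matrix Mathematics* (2nd ed.,
Princeton 2009), Fact 11.14.3 (`Dexp(A;B) = d/dt e^{A+tB}|₀ = ∫₀¹ e^{τA} B e^{(1−τ)A} dτ`) and Fact 11.14.4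
(`= ((e^{ad_A} − I)/ad_A)(B) e^A = Σ_k ad_A^k(B) e^A/(k+1)!`) [held corpus `book:bernstein2009-matrix-mathematics`,
PDF pp. 682–683, read 2026-08-19]; N. J. Higham, *Functions of Matrices* (SIAM 2008), ch. 10 [galaxy
panama:476045585154110].  The SERIES form proved here (`Σ_n (n!)⁻¹ Σ_{i+j=n−1} Aⁱ B Aʲ`) is the termwise derivative
from which both printed forms follow; the Duhamel-integral and `f(ad)` right-trivialised forms (the latter is what
G-pv03-9 (E1) uses) are NOT in this file — they are algebra on top of `fderiv_exp_apply`, left to a later module.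

DIVERGENCES / SCOPE.  (a) `[NormOneClass 𝔸]` (`‖1‖ = 1`) is assumed for the operator-norm bounds (it holds for the
`L²`-operator / C⋆ norm on matrices used by the cell's `UnitaryModel`, not for e.g. the Frobenius norm); the main
theorem inherits it.  (b) Scalars `𝕂 ∈ {ℝ, ℂ}` through `[RCLike 𝕂]`; a `ℂ`-derivative restricts to `ℝ` by
`HasFDerivAt.restrictScalars`.  (c) No `HasStrictFDerivAt` version (the series lemma gives `HasFDerivAt`; strictness
follows from analyticity if ever needed).

CHANGELOG.  v1.0 (2026-08-19, pub-balaban seat b2b-balaban-pv11-g7): first version.  v1.0.1 (same day, same seat):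
DOCSTRING-ONLY — «WHAT THE TREE ALREADY HAS» paragraph added (the tree's `ExpDuhamel` integral form; the v1.0 claim that
the tree had the derivative only at `0` withdrawn; delta stated); every declaration byte-identical to v1.0.
-/

noncomputable section

open NormedSpace Filter Topology
open scoped Nat RightActions

namespace Literature.Analysis.SpecialFunctions

namespace ExpFDeriv

variable (𝕂 : Type*) [RCLike 𝕂] {𝔸 : Type*} [NormedRing 𝔸] [NormedAlgebra 𝕂 𝔸]

/-- The `n`-th term of the derivative series of `exp` at `x`: the continuous linear map
`h ↦ (n!)⁻¹ • Σ_{i<n} x^{n−1−i} h x^i`, i.e. the derivative of `y ↦ (n!)⁻¹ • yⁿ` at `x`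
(`hasFDerivAt_pow'`). [folklore] -/
def term (x : 𝔸) (n : ℕ) : 𝔸 →L[𝕂] 𝔸 :=
  (n !⁻¹ : 𝕂) • ∑ i ∈ Finset.range n, x ^ (n.pred - i) •> ContinuousLinearMap.id 𝕂 𝔸 <• x ^ i

/-- The applied form of the `n`-th term. [folklore] -/
theorem term_apply (x h : 𝔸) (n : ℕ) :
    term 𝕂 x n h = (n !⁻¹ : 𝕂) • ∑ i ∈ Finset.range n, x ^ (n.pred - i) * h * x ^ i := by
  simp [term]

/-- The `0`-th term vanishes. [folklore] -/
@[simp] theorem term_zero (x : 𝔸) : term 𝕂 x 0 = 0 := by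
  simp [term]

/-- Each term is the Fréchet derivative of `y ↦ (n!)⁻¹ • yⁿ` (Mathlib's noncommutative power rule
`hasFDerivAt_pow'`). [folklore] -/
theorem hasFDerivAt_term (x : 𝔸) (n : ℕ) :
    HasFDerivAt (fun y : 𝔸 => (n !⁻¹ : 𝕂) • y ^ n) (term 𝕂 x n) x := by
  have h : HasFDerivAt ((n !⁻¹ : 𝕂) • fun y : 𝔸 => y ^ n) (term 𝕂 x n) x :=
    (hasFDerivAt_pow' (𝕜 := 𝕂) n).const_smul (n !⁻¹ : 𝕂)
  exact h

variable [NormOneClass 𝔸]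

/-- Operator-norm bound of the `n`-th term when `‖x‖ ≤ R`: `‖term x n‖ ≤ n R^{n−1} / n!`. [folklore] -/
theorem norm_term_le {R : ℝ} {x : 𝔸} (hx : ‖x‖ ≤ R) (n : ℕ) :
    ‖term 𝕂 x n‖ ≤ (n ! : ℝ)⁻¹ * (n * R ^ (n - 1)) := by
  have hR : 0 ≤ R := (norm_nonneg _).trans hx
  refine ContinuousLinearMap.opNorm_le_bound _ (by positivity) fun h => ?_
  rw [term_apply, norm_smul, norm_inv, RCLike.norm_natCast, mul_assoc]
  gcongr
  calc ‖∑ i ∈ Finset.range n, x ^ (n.pred - i) * h * x ^ i‖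
      ≤ ∑ i ∈ Finset.range n, ‖x ^ (n.pred - i) * h * x ^ i‖ := norm_sum_le _ _
    _ ≤ ∑ i ∈ Finset.range n, R ^ (n - 1) * ‖h‖ := by
        refine Finset.sum_le_sum fun i hi => ?_
        have hi' : i < n := Finset.mem_range.1 hi
        calc ‖x ^ (n.pred - i) * h * x ^ i‖ ≤ ‖x ^ (n.pred - i)‖ * ‖h‖ * ‖x ^ i‖ :=
              (norm_mul_le _ _).trans (mul_le_mul_of_nonneg_right (norm_mul_le _ _) (norm_nonneg _))
          _ ≤ R ^ (n.pred - i) * ‖h‖ * R ^ i := by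
              gcongr
              · exact (norm_pow_le x _).trans (pow_le_pow_left₀ (norm_nonneg _) hx _)
              · exact (norm_pow_le x _).trans (pow_le_pow_left₀ (norm_nonneg _) hx _)
          _ = R ^ (n - 1) * ‖h‖ := by
              rw [mul_right_comm, ← pow_add, Nat.pred_eq_sub_one, Nat.sub_add_cancel (by omega)]
    _ = n * R ^ (n - 1) * ‖h‖ := by
        rw [Finset.sum_const, Finset.card_range, nsmul_eq_mul]; ring

/-- The bounding sequence `n R^{n−1}/n!` (`= R^{n−1}/(n−1)!`) has sum `Real.exp R`. [folklore] -/
theorem hasSum_bound (R : ℝ) :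
    HasSum (fun n : ℕ => (n ! : ℝ)⁻¹ * (n * R ^ (n - 1))) (Real.exp R) := by
  have h1 : HasSum (fun n : ℕ => R ^ n / n !) (Real.exp R) := by
    rw [congr_fun Real.exp_eq_exp_ℝ R]
    exact expSeries_div_hasSum_exp R
  have h2 : (fun n : ℕ => ((n + 1) ! : ℝ)⁻¹ * (((n + 1 : ℕ) : ℝ) * R ^ (n + 1 - 1)))
      = fun n => R ^ n / n ! := by
    funext n
    rw [Nat.factorial_succ, Nat.cast_mul, Nat.add_sub_cancel]
    have hn : (n ! : ℝ) ≠ 0 := by positivity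
    have hn1 : ((n + 1 : ℕ) : ℝ) ≠ 0 := by positivity
    field_simp
  have h3 := (hasSum_nat_add_iff (f := fun n : ℕ => (n ! : ℝ)⁻¹ * (n * R ^ (n - 1))) 1).1
    (by rw [h2]; exact h1)
  simpa using h3

/-- The bounding sequence is summable. [folklore] -/
theorem summable_bound (R : ℝ) : Summable fun n : ℕ => (n ! : ℝ)⁻¹ * (n * R ^ (n - 1)) :=
  (hasSum_bound R).summable

/-- The derivative series `Σ_n term x n` is absolutely summable in operator norm. [folklore] -/
theorem summable_norm_term (x : 𝔸) : Summable fun n => ‖term 𝕂 x n‖ :=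
  Summable.of_nonneg_of_le (fun _ => norm_nonneg _) (fun n => norm_term_le 𝕂 le_rfl n)
    (summable_bound ‖x‖)

variable [CompleteSpace 𝔸]

/-- The derivative series `Σ_n term x n` is summable in operator norm. [folklore] -/
theorem summable_term (x : 𝔸) : Summable fun n => term 𝕂 x n :=
  (summable_norm_term 𝕂 x).of_norm

/-- **The Fréchet derivative of `exp` at a general point** of a complete normed algebra over `ℝ` or
`ℂ` (noncommutative; `‖1‖ = 1`): `D exp(x) = Σ_n (n!)⁻¹ Σ_{i<n} x^{n−1−i} (·) x^i` — the termwise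
derivative of the exponential series, converging in operator norm. [folklore] -/
theorem hasFDerivAt_exp (x : 𝔸) : HasFDerivAt (exp : 𝔸 → 𝔸) (∑' n, term 𝕂 x n) x := by
  letI : NormedSpace ℝ 𝔸 := NormedSpace.restrictScalars ℝ 𝕂 𝔸
  set R : ℝ := ‖x‖ + 1 with hR
  have hs : IsOpen (Metric.ball (0 : 𝔸) R) := Metric.isOpen_ball
  have hs' : IsPreconnected (Metric.ball (0 : 𝔸) R) := Metric.isPreconnected_ball
  have hx : x ∈ Metric.ball (0 : 𝔸) R := by simp [hR]
  have h0 : (0 : 𝔸) ∈ Metric.ball (0 : 𝔸) R := by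
    simp only [Metric.mem_ball, dist_zero_right, norm_zero, hR]; positivity
  have hmain := hasFDerivAt_tsum_of_isPreconnected (summable_bound R) hs hs'
    (fun n y _ => hasFDerivAt_term 𝕂 y n)
    (fun n y hy => norm_term_le 𝕂 (le_of_lt (by simpa using hy)) n) h0
    (expSeries_summable' (𝕂 := 𝕂) (0 : 𝔸)) hx
  rw [exp_eq_tsum 𝕂]
  exact hmain

/-- `exp` is differentiable at every point (with the explicit derivative above). [folklore] -/
theorem differentiableAt_exp (x : 𝔸) : DifferentiableAt 𝕂 (exp : 𝔸 → 𝔸) x :=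
  (hasFDerivAt_exp 𝕂 x).differentiableAt

/-- `exp` is differentiable. [folklore] -/
theorem differentiable_exp : Differentiable 𝕂 (exp : 𝔸 → 𝔸) := fun x =>
  differentiableAt_exp 𝕂 x

/-- The Fréchet derivative of `exp` is the derivative series. [folklore] -/
theorem fderiv_exp (x : 𝔸) : fderiv 𝕂 (exp : 𝔸 → 𝔸) x = ∑' n, term 𝕂 x n :=
  (hasFDerivAt_exp 𝕂 x).fderiv

/-- The applied form: `D exp(x) h = Σ_n (n!)⁻¹ Σ_{i<n} x^{n−1−i} h x^i`. [folklore] -/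
theorem fderiv_exp_apply (x h : 𝔸) :
    (∑' n, term 𝕂 x n) h
      = ∑' n : ℕ, (n !⁻¹ : 𝕂) • ∑ i ∈ Finset.range n, x ^ (n.pred - i) * h * x ^ i := by
  have happ := (ContinuousLinearMap.apply 𝕂 𝔸 h).map_tsum (summable_term 𝕂 x)
  simp only [ContinuousLinearMap.apply_apply] at happ
  rw [happ]
  simp_rw [term_apply]

omit [CompleteSpace 𝔸] in
/-- Operator-norm bound: `‖D exp(x)‖ ≤ e^{‖x‖}`. [folklore] -/
theorem norm_fderiv_exp_le (x : 𝔸) : ‖∑' n, term 𝕂 x n‖ ≤ Real.exp ‖x‖ :=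
  tsum_of_norm_bounded (hasSum_bound ‖x‖) fun n => norm_term_le 𝕂 le_rfl n

/-- The directional derivative along an affine line: `d/dt exp(x + t h) = D exp(x + t h) h`.
[folklore] -/
theorem hasDerivAt_exp_add_smul (x h : 𝔸) (t : 𝕂) :
    HasDerivAt (fun s : 𝕂 => exp (x + s • h)) ((∑' n, term 𝕂 (x + t • h) n) h) t := by
  have hline : HasDerivAt (fun s : 𝕂 => x + s • h) h t := by
    simpa using ((hasDerivAt_id t).smul_const h).const_add x
  exact (hasFDerivAt_exp 𝕂 (x + t • h)).comp_hasDerivAt t hline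

/-- Sanity / commuting case: on a direction `h` commuting with `x` the derivative is `h · exp x`
(each inner sum collapses to `n x^{n−1} h`, and `Σ_{n≥1} x^{n−1}/(n−1)! = exp x`). [folklore] -/
theorem fderiv_exp_apply_of_commute {x h : 𝔸} (hxh : Commute x h) :
    (∑' n, term 𝕂 x n) h = h * exp x := by
  rw [fderiv_exp_apply]
  -- the collapsed general term
  set g : ℕ → 𝔸 := fun m => ((m ! : 𝕂)⁻¹ * m) • (h * x ^ (m - 1)) with hg_def
  have hterm : ∀ n : ℕ, ((n !⁻¹ : 𝕂) • ∑ i ∈ Finset.range n, x ^ (n.pred - i) * h * x ^ i)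
      = g n := by
    intro n
    have hcomm : ∀ i ∈ Finset.range n, x ^ (n.pred - i) * h * x ^ i = h * x ^ (n - 1) := by
      intro i hi
      have hi' : i < n := Finset.mem_range.1 hi
      rw [(hxh.pow_left _).eq, mul_assoc, ← pow_add, Nat.pred_eq_sub_one,
        Nat.sub_add_cancel (by omega)]
    rw [Finset.sum_congr rfl hcomm, Finset.sum_const, Finset.card_range, ← Nat.cast_smul_eq_nsmul 𝕂,
      smul_smul, hg_def]
  rw [tsum_congr hterm]
  -- the shifted general term
  have hg : ∀ n : ℕ, g (n + 1) = h * ((n !⁻¹ : 𝕂) • x ^ n) := by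
    intro n
    have hn : (n ! : 𝕂) ≠ 0 := Nat.cast_ne_zero.2 (Nat.factorial_pos n).ne'
    have hn1 : ((n + 1 : ℕ) : 𝕂) ≠ 0 := Nat.cast_ne_zero.2 (Nat.succ_ne_zero n)
    have hcoef : (((n + 1) ! : 𝕂)⁻¹ * ((n + 1 : ℕ) : 𝕂)) = (n ! : 𝕂)⁻¹ := by
      rw [Nat.factorial_succ, Nat.cast_mul, mul_inv, mul_comm ((((n + 1 : ℕ) : 𝕂))⁻¹), mul_assoc,
        inv_mul_cancel₀ hn1, mul_one]
    simp only [hg_def, Nat.add_sub_cancel, hcoef, mul_smul_comm]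
  have hg0 : g 0 = 0 := by simp [hg_def]
  have hsum : Summable fun n : ℕ => (n !⁻¹ : 𝕂) • x ^ n := expSeries_summable' x
  have hsum' : Summable fun n : ℕ => g (n + 1) := by
    rw [funext hg]; exact hsum.mul_left h
  rw [tsum_eq_zero_add' hsum', hg0, zero_add, tsum_congr hg, hsum.tsum_mul_left h,
    congr_fun (exp_eq_tsum 𝕂) x]

end ExpFDeriv

end Literature.Analysis.SpecialFunctions

end
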